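import Mathlib
import HarnessLib
import HarnessLib.Audit
import Summits.HodgeConjecture.Statement
import Literature.AlgebraicGeometry.HodgeTheory.ComplexGysin
import Literature.AlgebraicGeometry.Motives.Sweep1
import Literature.AlgebraicGeometry.Motives.AbelianVariety
import Summits.HodgeConjecture.HodgeConjecture.Theorems.CurveNetMordellWeilComplexOrientationExists
import Summits.HodgeConjecture.HodgeConjecture.Theorems.CurveNetMordellWeilHodgeModels

/-!
Route: SupersingularIsotypicLift

DORMANT since 2026-09-04T17:26:00Z (reconciler: no traction for 5 d (last activity statement-checked at 2026-08-30T16:05:13Z); parked, not closed — `ledger route dormant route-HodgeConjecture-SupersingularIsotypicLift --off` to reactiva) — unstaffed, not closed; items shared with open routes are served there. `ledger route dormant <id> --off` reactivates.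

Route SupersingularIsotypicLift (realises idea card supersingular-isotypic-lift). It suffices to
show the conjunction of
(LIFT) ISOTYPIC HODGE CLASSES ARE ALGEBRAIC: on a smooth projective complex X, every RATIONAL class
c ∈ H²ᵖ(X(ℂ);ℂ) fixed by a ℚ-rational algebraic self-correspondence action P of X whose image
consists of (p,p)-classes lies in algebraicClasses X p. Here P = P_γ : β ↦ pr₁₊(pr₂*β ∪ γ) for a
class γ ∈ Nⁿ H²ⁿ((X×X)(ℂ);ℂ) = algebraicClasses (X ⊗ X) n (ℂ-span of codimension-n cycle classes on
X × X), required to preserve rational classes; pr₁₊ is the real Gysin map `complexGysin μ` of an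
orientation family μ with Poincaré duality (any two such μ differ by locally constant scalars,
absorbed into γ). Decl IsotypicClassesAlgebraic.
(ENV) EVERY HODGE CLASS IS ENVELOPED: each rational (p,p)-class c is fixed by such a P (a rational
algebraic correspondence mapping H²ᵖ into Hodge classes and fixing c). Decl HodgeClassesEnveloped.
HC ⟺ LIFT ∧ ENV: "⇐" is pure logic and is the Assembly (OrientationData → HodgeModels →
IsotypicClassesAlgebraic → HodgeClassesEnveloped → HodgeConjecture; term-checked in the planner's
Sketch.lean); "⇒" uses HC on X × X plus B ⇒ D over ℂ (Lieberman1968) to make the projector Σ aᵢ ⊗ bᵢ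
onto Hdgᵖ(X) algebraic. ENV is a THEOREM for CM-type motives — Fermat/Delsarte hypersurfaces
(Galois-stable sums of μ_m-character idempotents, Shioda1979HodgeFermat) and CM abelian varieties
(CM idempotents, Pohlmann1968) — and is deliberately NOT decomposed here. LIFT is the card's target
and is attacked p-adically FROM A SUPERSINGULAR PRIME: at p ≡ −1 (mod m) for the Fermat scheme
(ShiodaKatsura1979) resp. at primes with Frobenius = complex conjugation for a CM abelian scheme,
the reduction X₁ has H²ᵖ_cris(X₁/W)_K spanned by cycle classes (Tate input free, hom = num); because
the piece N = P(H²ᵖ(X,ℚ)) is cut out by an ALGEBRAIC correspondence with N ⊗ ℂ ⊂ H^{p,p}, N_dR ⊂ Fᵖ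
and every ξ ∈ P(CHᵖ(X₁)_ℚ) satisfies the Bloch–Esnault–Kerz criterion Φ⁻¹ch(ξ) ∈ Fᵖ
(BlochEsnaultKerz2014pAdic, Thm 1.3; p > dim + 6, W(k) unramified hold by construction), hence lifts
to (lim_n K₀(X_n))_ℚ; the single open input ALG (algebraization of pro-K₀ classes = the open half of
the p-adic variational Hodge conjecture, CostaSertoz2021 §1.1, AntieauMathewMorrowNikolaus2022 Conj.
1.3) then gives classes algebraic on X_K spanning N_dR, and (V ⊗ ℂ) ∩ H_ℚ = V returns to Betti. ALG
is the rank-2 crux (informal until K₀-of-schemes / crystalline cycle-class definitions land).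
Milestone special cases filed as support: FermatHodge (HC for Fermat hypersurfaces of every degree
and dimension; known only for m prime or m ≤ 20) and CMAbelianHodge (HC for CM abelian varieties; by
Pohlmann1968/Milne1999 it implies the Tate conjecture for abelian varieties over finite fields).
One-line Lean form of X: IsotypicClassesAlgebraic ∧ HodgeClassesEnveloped (both stated over
Literature.AlgebraicGeometry.HodgeTheory.{complexBetti, complexBetti.map, complexGysin,
OrientationFamily.HasPoincareDuality, algebraicClasses, IsRationalClass, IsOfHodgeType},
Literature.AlgebraicTopology.SingularHomology.cupProduct,
Literature.AlgebraicGeometry.Motives.IsSmoothProjective.tensor_holds — every constant checked with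
lean search / lean check rc 0).

Rationale: WHY THIS LINE (imports p-adic Hodge theory / K-theory into the complex-analytic statement). The
usual p-adic bridge "Tate ⟹ Hodge" needs two conditional inputs besides algebraization: the Tate
conjecture over 𝔽_q in codimension p and de Rham–crystalline rationality of the Hodge class
(absolute-Hodge type input). Both disappear in the regime of the card: at a SUPERSINGULAR prime (p ≡
−1 mod m for Fermat X^n_m, unirational there, ShiodaKatsura1979; Frobenius = complex conjugation
primes for a CM abelian scheme, reduction ~ E^g) every class of the reduction is a cycle, and for a
piece N cut out by a rational ALGEBRAIC correspondence with N ⊗ ℂ ⊂ H^{p,p} the Bloch–Esnault–Kerz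
lifting criterion (BlochEsnaultKerz2014pAdic Thm 1.3) holds for every rational cycle class of the
reduction inside the piece. So "ALG alone ⟹ HC for all Fermat/Delsarte hypersurfaces and all CM
abelian varieties", and by Pohlmann1968/Milne1999 then Tate for abelian varieties over finite
fields. To make this a route to the SUMMIT (not only to a sub-family) the thesis splits HC ⟺ ENV ∧
LIFT along exactly the hypothesis the mechanism consumes (isotypy for an algebraic correspondence),
in the spirit of Charles–Schnell's split Hodge ⇒ absolute Hodge ⇒ algebraic (CharlesSchnell2014Notes
Conj. 11.2.17/11.2.18, book pp. 473–474) but WITHOUT Aut(ℂ)-conjugation: only de Rham/crystalline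
realizations of algebraically-cut pieces travel.
RANKED CRUXES. r2 ALG (informal; filed right after open): for X smooth projective over W(k), p > dim
X_k + 6, every (ξ_n) ∈ (lim_n K₀(X_n))_ℚ has crystalline Chern character in the ℚ_p-span of Chern
characters of K₀(X)_ℚ — BEK's "origin more mysterious" half; needed only for Fermat schemes over ℤ_p
and CM abelian schemes over W(k). r3 IsotypicClassesAlgebraic (LIFT, typed): the card's EXT-level
statement; provable from ALG + BEK + a supersingular (or Tate-trivial) prime; for (X,P) with no such
prime the span input degrades to Tate/𝔽_q (the card's unconditional unit-root/Kronecker lemma gives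
finiteness of the Galois action on P H_ℓ, filed as support). r4 HodgeClassesEnveloped (ENV, typed):
the complementary half; theorem for CM-type motives, for abelian varieties reduces to B for compact
pencils (Andre1996Motifs §6.3 Rem. 2); left to André/standard-conjecture methods, not to this
mechanism.
SUPPORT (typed): OrientationData (∃ orientation family with Poincaré duality: complex orientations +
HatcherAT2002 Thm 3.30), HodgeModels (= nonempty_hodgeModel for all X; SerreGAGA1956 + Hodge
decomposition), FermatHodge, CMAbelianHodge (milestones = LIFT ∧ ENV on the two families; ENV known
there). SUPPORT (informal): SupersingularSpan (S1), IsotypicPotentiallyTate (side lemma), BEK Thm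
1.3 as a Literature fact (cite item).
KILL CRITERIA. (i) A phantom class: an element of (lim K₀(X_n))_ℚ on E × E′/W (supersingular prime)
or on a Fermat surface scheme whose Chern character is not in the span of algebraic classes refutes
ALG and closes the route (HC is known there, so the test is decisive; CostaSertoz2021's algorithm
computes the obstruction side). (ii) A refutation of FermatHodge or CMAbelianHodge refutes HC
itself. (iii) ENV refuted for some (X,p) also refutes HC (ENV ⇐ HC), so ¬ENV is a refutation channel
for the summit, not only for the route.
DELIBERATELY NOT DECOMPOSED: the proof of LIFT from ALG (split later into ALG / supersingular-span /
BEK-criterion children once ALG is typed); ENV beyond CM type; Delsarte quotients and products of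
Fermat varieties; removal of p > dim + 6 via AntieauMathewMorrowNikolaus2022.
NOVELTY: see --novelty (nearest prior art BlochEsnaultKerz2014pAdic, CostaSertoz2021, Pohlmann1968,
ShiodaKatsura1979, Andre1996Motifs; delta = supersingular prime + algebraic isotypy remove the Tate
and absolute-Hodge inputs; the ENV/LIFT split of HC along algebraic isotypy).
BARRIERS: see --barriers (integral-coefficient, conjugate-variety, absolute-Hodge,
exceptional-class, motivated-class, Griffiths-group and generalized-Hodge barriers addressed;
technique_class p-adic-lifting isotypic-correspondences).

Novelty: NOVELTY (searched before writing: lit search --hybrid "p-adic variational Hodge conjecture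
deformation of algebraic cycle classes continuous K-theory algebraization" (held: Voisin I/II,
Green–Murre–Voisin 1994, Cattani et al. 2014 pp. 473–482 READ, Jannsen 1988, Deligne LNM 900); lit
galaxy search "p-adic variational Hodge conjecture" --star all (1 hit: CostaSertoz2021 =
arXiv:2003.11037, pp. 1–4 READ); lit search --source s2 "lifting algebraic cycles from supersingular
Fermat variety" (nothing relevant); lit frontier HodgeConjecture --since 2020 (no
supersingular-prime lifting route; nearest: arXiv:2603.20268 on Weil loci of sixfolds); ledger
negatives --problem HodgeConjecture (0); the card's own audit r14 of BlochEsnaultKerz2014pAdic).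
Nearest prior art: (1) BlochEsnaultKerz2014pAdic (Invent. 195, arXiv:1203.2776) Thm 1.3 — rational
p-adic lifting criterion Φ⁻¹ch(ξ) ∈ Fʳ for ξ ∈ K₀(X₁)_ℚ, p > d + 6, into (lim K₀(X_n))_ℚ, with the
algebraization half (ALG) isolated and open; no application to Fermat varieties, abelian varieties
or supersingular fibres. (2) CostaSertoz2021 (arXiv:2003.11037) §1.1 — uses the SAME obstruction map
at ONE prime reduction of a hypersurface, but to BOUND middle Picard numbers from above (obstructed
classes do not lift); states that lifting to X beyond r = 1 is unknown. (3) Pohlmann1968 / Milne1999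
— HC for CM abelian varieties ⟺/⟹ Tate conjectures; Shioda1979HodgeFermat/Aoki1987 — HC for Fermat
X^n_m via the inductive structure and condition (P^n_  [refs: 2003.11037, 2603.20268, 1203.2776, CostaSertoz2021, Pohlmann1968, Milne1999, Aoki1987, ShiodaKatsura1979, AntieauMathewMorrowNikolaus2022]

Barriers (technique_class: p-adic-lifting isotypic-correspondences): technique_class: p-adic-lifting isotypic-correspondences
- Literature.Barriers.HodgeConjecture.AtiyahHirzebruch1962_torsionClass_notAlgebraic: everything is
⊗ℚ — rational classes, cycles modulo numerical equivalence ⊗ℚ on the reduction, BEK's criterion and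
ALG are rational statements; torsion phenomena are invisible and not contradicted.
- Literature.Barriers.HodgeConjecture.Kollar1992_nonTorsionClass_notAlgebraic: the route never
asserts an INTEGRAL class is algebraic; conclusions are membership in the ℂ-span algebraicClasses X
p of cycle classes (ℚ-span for rational classes).
- Literature.Barriers.HodgeConjecture.Serre1964_conjugateVarieties_notHomeomorphic: no Betti class
is transported along Aut(ℂ) or to characteristic p; only the de Rham / crystalline realizations of
the piece N = P(H) cut by an ALGEBRAIC correspondence travel (Berthelot–Ogus), and the return to
Betti is the linear-algebra step (V ⊗ ℂ) ∩ H_ℚ = V.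
- Literature.Barriers.HodgeConjecture.Charles2009_conjugateVarieties_cohomologyAlgebrasNotIso: same
evasion — the rational cohomology algebra is never defined algebraically; the ℚ-structure used on
the p-adic side is that of cycles on the reduction, not conjugate Betti lattices.
- Literature.Barriers.HodgeConjecture.hodgeClassesAreAbsoluteFor_abelianVariety: proof-side route;
absoluteness of Hodge classes is neither used nor claimed (isotypy for an algebraic correspondence
replaces it), so a non-absolute Hodge class elsewhere would not touch LIFT; ENV for abelia

History (route lifecycle, newest last):
- 2026-08-15T11:12:27Z · rev 1: dropped stmt-HodgeConjecture-3152 — drop stmt-HodgeConjecture-3152: accidental duplicate informal placeholder (informal text 'x') created by a mistyped CLI call; the genuine rank-2 crux ALG is stm (planner-plancard-HodgeConjecture-HodgeConject-14bb6f99-0)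
- 2026-08-16T02:17:46Z · AUTO-CRUX: 1 conjecture-grade item(s) promoted to crux (CMAbelianHodge) — refuter vetting / tiering apply (operator:999:1362873)
- 2026-08-26T12:41:46Z · DORMANT — reconciler: no traction for 7.4 d (last activity item-evidence-added at 2026-08-19T02:06:35Z); parked, not closed — `ledger route dormant route-HodgeConjecture- (operator:999:2637540)
- 2026-08-28T02:02:16Z · REACTIVATED — reconciler: reactivated — activity statement-attached at 2026-08-28T00:21:08Z after parking at 2026-08-26T12:41:46Z (operator:999:2308867)
- 2026-09-04T17:26:00Z · DORMANT — reconciler: no traction for 5 d (last activity statement-checked at 2026-08-30T16:05:13Z); parked, not closed — `ledger route dormant route-HodgeConjecture-Supe (operator:999:1459025)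

sub-problem: HodgeConjecture · status: dormant · opened planner-plancard-HodgeConjecture-HodgeConject-14bb6f99-0 2026-08-15T11:10:29Z · rev 4 · ledger route-HodgeConjecture-SupersingularIsotypicLift
GENERATED by the gate from the ledger (D-0016/17). Provers cite these decls: `theorem foo : Summit.HodgeConjecture.HodgeConjecture.Theses.SupersingularIsotypicLift.<Decl> := …` in Summits/HodgeConjecture/HodgeConjecture/Theorems/<Name>.lean.
-/

namespace Summit.HodgeConjecture.HodgeConjecture.Theses.SupersingularIsotypicLift

open scoped BigOperators Topology Manifold Classical MeasureTheory ProbabilityTheory Matrix InnerProductSpace ComplexConjugate ContinuousMap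
open Filter Set Function TopologicalSpace MeasureTheory

attribute [summit_statement] _root_.HodgeConjecture

-- item stmt-HodgeConjecture-3116 · crux · rank 2 · open · by planner — informal only, no Lean statement yet:
--   [crux] ALG — p-ADIC ALGEBRAIZATION OF PRO-K₀ CLASSES (rank 2; the single open input of the
--   mechanism; informal until the definitions K₀-of-schemes ⊗ ℚ, the p-adic thickening tower X_n = X ⊗
--   W/p^{n+1}, and a crystalline cycle class / Chern character into H²ʳ_dR(X/W)[1/p] land — definition
--   requests filed). STATEMENT: let k be a perfect field of characteristic p (here finite), W = W(k), K
--   = Frac W, X → Spec W smooth PROJECTIVE of relative dimension d with p > d + 6, X₁ = X ⊗ k, X_n = X ⊗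
--   W/p^{n+1}. Then for every r and every compatible system (ξ_n)_n ∈ (lim_n K₀(X_n)) ⊗ ℚ there is ξ ∈
--   K₀(X) ⊗ ℚ (

/-- item stmt-HodgeConjecture-3048 · crux · rank 3 · open · by planner
why it might fail: HC ⟹ LIFT, so false only with HC; but as typed (all X, all enveloping P) it contains HC for CM abelian varieties, all Fermat X^n_m and all Hodge–Weil classes (the K-action envelopes the Weil plane; open for n ≥ 4); the supersingular/BEK mechanism covers cycle-spanned reductions only, else Tate/F_q
sources: BlochEsnaultKerz2014pAdic, ShiodaKatsura1979, Pohlmann1968, Milne1999, Markman2025SecantWeil, MoonenZarhin1999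
[crux] LIFT — ISOTYPIC HODGE CLASSES ARE ALGEBRAIC. For every orientation family μ with Poincaré
duality, every smooth projective complex X (dim n), p, and γ ∈ algebraicClasses (X ⊗ X) n (ℂ-span of
codimension-n cycle classes on X × X) whose correspondence action P β = pr₁₊(pr₂*β ∪ γ) (pr₁₊ =
complexGysin μ) preserves rational classes and has image consisting of (p,p)-classes: every rational
c with P c = c lies in algebraicClasses X p. The card's EXT-level statement (isotypic pieces N =
P(H²ᵖ(X,ℚ)), N ⊗ ℂ ⊂ H^{p,p}); contains HC for Fermat/Delsarte hypersurfaces and CM abelian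
varieties (where ENV is known). Intended proof: supersingular (or Tate-trivial) prime ⇒ N_cris
spanned by cycle classes; algebraic isotypy ⇒ N_dR ⊂ Fᵖ ⇒ BEK criterion for every ξ ∈ P(CHᵖ(X₁)_ℚ) ⇒
lift to pro-K₀ (BlochEsnaultKerz2014pAdic Thm 1.3) ⇒ ALG ⇒ algebraic on X_K ⇒ (V⊗ℂ) ∩ H_ℚ = V. P may
be any ℚ-rational element of (correspondence actions) ⊗ ℂ: rationality-preservation + γ algebraic
force P into the ℚ-span of genuine cycle actions (linear algebra), whatever the scaling of μ.
Sources: BlochEsnaultKerz2014pAdic, ShiodaKatsura1979, Pohlmann1968, CostaSertoz2021,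
AntieauMathewMorrowNikolaus2022. -/
@[route_item "route-HodgeConjecture-SupersingularIsotypicLift"]
def IsotypicClassesAlgebraic : Prop :=
  ∀ (μ : Literature.AlgebraicGeometry.HodgeTheory.OrientationFamily), μ.HasPoincareDuality → ∀ ⦃n : ℕ⦄ ⦃X : Literature.AlgebraicGeometry.Motives.SchemeOver ℂ⦄ (hX : Literature.AlgebraicGeometry.Motives.IsSmoothProjective n X) (p : ℕ) (γ : Literature.AlgebraicGeometry.HodgeTheory.complexBetti (CategoryTheory.MonoidalCategoryStruct.tensorObj X X) (2 * n)), γ ∈ Literature.AlgebraicGeometry.HodgeTheory.algebraicClasses (CategoryTheory.MonoidalCategoryStruct.tensorObj X X) n → let P : Literature.AlgebraicGeometry.HodgeTheory.complexBetti X (2 * p) → Literature.AlgebraicGeometry.HodgeTheory.complexBetti X (2 * p) := fun β => Literature.AlgebraicGeometry.HodgeTheory.complexGysin μ (Literature.AlgebraicGeometry.Motives.IsSmoothProjective.tensor_holds hX hX) hX (CategoryTheory.CartesianMonoidalCategory.fst X X) (show 2 * p + 2 * n + 2 * n = 2 * p + 2 * (n + n) by ring) (Literature.AlgebraicTopology.SingularHomology.cupProduct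 (rfl : 2 * p + 2 * n = 2 * p + 2 * n) (Literature.AlgebraicGeometry.HodgeTheory.complexBetti.map (CategoryTheory.CartesianMonoidalCategory.snd X X) (2 * p) β) γ); (∀ β, Literature.AlgebraicGeometry.HodgeTheory.IsRationalClass β → Literature.AlgebraicGeometry.HodgeTheory.IsRationalClass (P β)) → (∀ β, Literature.AlgebraicGeometry.HodgeTheory.IsOfHodgeType n X (2 * p) p p (P β)) → ∀ c, Literature.AlgebraicGeometry.HodgeTheory.IsRationalClass c → P c = c → c ∈ Literature.AlgebraicGeometry.HodgeTheory.algebraicClasses X p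

/-- item stmt-HodgeConjecture-3049 · crux · rank 4 · open · by planner
why it might fail: HC ⟹ ENV, so false only with HC. Known where Hodge classes are cut out by endomorphisms/automorphisms (CM, Fermat, Weil planes ∧^{2n}_K H¹, contra the filed note); open where only MOTIVATED projectors exist: abelian varieties need B on compact pencils (Andre1996Motifs §6.3 Rem 2); general X: none
sources: Andre1996Motifs, Lieberman1968, Deligne1982HodgeCycles, MoonenZarhin1999, vanGeemen1994HodgeAV, Shioda1979HodgeFermat
[crux] ENV — EVERY HODGE CLASS IS ENVELOPED BY A RATIONAL ALGEBRAIC CORRESPONDENCE WITH (p,p) IMAGE.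
For every μ with Poincaré duality, smooth projective X, p, and rational (p,p)-class c there is γ ∈
algebraicClasses (X ⊗ X) n whose action P (same expression as in IsotypicClassesAlgebraic) preserves
rational classes, has image of Hodge type (p,p), and fixes c. HC ⟹ ENV (HC on X × X + B ⇒ D over ℂ,
Lieberman1968: π = Σ aᵢ ⊗ bᵢ with algebraic dual bases; rescale γ by the scalar relating μ to the
complex orientation), and ENV ∧ LIFT ⟹ HC is the Assembly. KNOWN: Fermat/Delsarte (Galois-stable
sums of μ_m-character idempotents, graphs of automorphisms; Shioda1979HodgeFermat), CM abelian
varieties (CM idempotents via endomorphisms; Pohlmann1968), degree 2 (Lefschetz (1,1) + Hodge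
index). OPEN: abelian varieties in general (reduces to standard conjecture B for compact pencils,
Andre1996Motifs §6.3 Rem. 2), very general Weil-type 2n-folds, general X. Deliberately NOT
decomposed in this route (André/standard-conjecture territory). Sources: Andre1996Motifs,
Lieberman1968, Kleiman1968, CharlesSchnell2014Notes, Shioda1979HodgeFermat, Markman2025SecantWeil. -/
@[route_item "route-HodgeConjecture-SupersingularIsotypicLift"]
def HodgeClassesEnveloped : Prop :=
  ∀ (μ : Literature.AlgebraicGeometry.HodgeTheory.OrientationFamily), μ.HasPoincareDuality → ∀ ⦃n : ℕ⦄ ⦃X : Literature.AlgebraicGeometry.Motives.SchemeOver ℂ⦄ (hX : Literature.AlgebraicGeometry.Motives.IsSmoothProjective n X) (p : ℕ) (c : Literature.AlgebraicGeometry.HodgeTheory.complexBetti X (2 * p)), Literature.AlgebraicGeometry.HodgeTheory.IsRationalClass c → Literature.AlgebraicGeometry.HodgeTheory.IsOfHodgeType n X (2 * p) p p c → ∃ γ ∈ Literature.AlgebraicGeometry.HodgeTheory.algebraicClasses (CategoryTheory.MonoidalCategoryStruct.tensorObj X X) n, let P : Literature.AlgebraicGeometry.HodgeTheory.complexBetti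 X (2 * p) → Literature.AlgebraicGeometry.HodgeTheory.complexBetti X (2 * p) := fun β => Literature.AlgebraicGeometry.HodgeTheory.complexGysin μ (Literature.AlgebraicGeometry.Motives.IsSmoothProjective.tensor_holds hX hX) hX (CategoryTheory.CartesianMonoidalCategory.fst X X) (show 2 * p + 2 * n + 2 * n = 2 * p + 2 * (n + n) by ring) (Literature.AlgebraicTopology.SingularHomology.cupProduct (rfl : 2 * p + 2 * n = 2 * p + 2 * n) (Literature.AlgebraicGeometry.HodgeTheory.complexBetti.map (CategoryTheory.CartesianMonoidalCategory.snd X X) (2 * p) β) γ); (∀ β, Literature.AlgebraicGeometry.HodgeTheory.IsRationalClass β → Literature.AlgebraicGeometry.HodgeTheory.IsRationalClass (P β)) ∧ (∀ β, Literature.AlgebraicGeometry.HodgeTheory.IsOfHodgeType n X (2 * p) p p (P β)) ∧ P c = c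

/-- item stmt-HodgeConjecture-3052 · crux (kind.auto-crux: conjecture-grade) · rank 9 · open · by planner
why it might fail: auto-crux — conjecture-grade statement (docstring avows it ('conjecture')); it is open, so it may simply be false
sources: Pohlmann1968, Milne1999, Deligne1982HodgeCycles, vanGeemen1994HodgeAV
[support] MILESTONE: the Hodge conjecture for complex abelian varieties of CM type (End⁰(A) ⊇ a
commutative reduced ℚ-subalgebra of dimension 2 dim A; smooth-projectivity quantified as a witness
as in the barrier files). Open in general (Pohlmann1968: equivalent to the Tate conjecture for A;
Milne1999: implies Tate for all abelian varieties over finite fields; known for nondegenerate CM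
types, prime dimension, special Weil-type examples — vanGeemen1994HodgeAV §4). In this route it is
LIFT ∧ ENV on the CM family: ENV holds by CM idempotents (Pohlmann1968), LIFT is to come from ALG
via primes of supersingular reduction (Frobenius = complex conjugation in the reflex closure;
positive density, unramified, p > g + 6) where A₁ ~ E^g and H^{2p} is spanned by products of
divisors. Sources: Pohlmann1968, Milne1999, Deligne1982HodgeCycles, vanGeemen1994HodgeAV. -/
@[route_item "route-HodgeConjecture-SupersingularIsotypicLift"]
def CMAbelianHodge : Prop :=
  ∀ (A : Literature.AlgebraicGeometry.Motives.AbelianVariety ℂ), Literature.AlgebraicGeometry.Motives.IsSmoothProjective A.dim A.X → (∃ S : Subalgebra ℚ A.endAlgebra, IsReduced ↥S ∧ (∀ x ∈ S, ∀ y ∈ S, x * y = y * x) ∧ Module.finrank ℚ ↥S = 2 * A.dim) → Literature.AlgebraicGeometry.HodgeTheory.HodgeConjectureFor A.dim A.X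

/-- item stmt-HodgeConjecture-2789 · support · rank 9 · closed · proved by Summit.HodgeConjecture.HodgeConjecture.Theorems.complexOrientationExists_proof @ aadedb270015 (prover) · by planner
sources: HatcherAT2002, FultonYoungTableaux1997
[support] COMPLEX ORIENTATIONS EXIST AND SATISFY POINCARÉ DUALITY: there is an OrientationFamily μ
(a ℂ-orientation of the closed 2n-manifold X(ℂ) for every smooth projective X of dimension n) with
μ.HasPoincareDuality. Intended witness: the complex orientation (holomorphic charts of the GAGA
atlas Motives.ComplexPoints.chartedSpace are orientation-preserving, so the local classes glue:
HomologicalOrientation.ofLocalFamily), and Poincaré duality for closed oriented manifolds (Hatcher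
Thm. 3.30 = the tree's named fact bijective_poincareDualityMap;
OrientationFamily.hasPoincareDuality_of turns it into HasPoincareDuality). Every Gysin statement of
the route quantifies over such μ; this item discharges the quantifier in the Assembly. -/
@[route_item "route-HodgeConjecture-SupersingularIsotypicLift"]
def OrientationData : Prop :=
  ∃ μ : Literature.AlgebraicGeometry.HodgeTheory.OrientationFamily, μ.HasPoincareDuality

/-- `OrientationData` holds: proved by `Summit.HodgeConjecture.HodgeConjecture.Theorems.complexOrientationExists_proof` @ aadedb270015. -/
theorem OrientationData_holds : OrientationData := _root_.Summit.HodgeConjecture.HodgeConjecture.Theorems.complexOrientationExists_proof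

/-- item stmt-HodgeConjecture-3050 · support · rank 9 · closed · proved by Summit.HodgeConjecture.HodgeConjecture.Theorems.curveNetMordellWeil_hodgeModels_proof @ a3022ab2aaa0 (prover) · by planner
sources: SerreGAGA1956, VoisinHodgeI2002
[support] Every smooth projective complex variety has a Hodge model (analytification + natural de
Rham comparison + Hodge decomposition): literally ∀ n X,
Literature.AlgebraicGeometry.HodgeTheory.nonempty_hodgeModel n X (named fact,
HodgeModelExistence.lean; conditional assembly nonempty_hodgeModel_of in HodgeModelExistenceProofs).
Supplies the anti-vacuity conjunct of HodgeConjectureFor in the Assembly. Sources: SerreGAGA1956,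
VoisinHodgeI2002 Thm 6.18. -/
@[route_item "route-HodgeConjecture-SupersingularIsotypicLift"]
def HodgeModels : Prop :=
  ∀ ⦃n : ℕ⦄ ⦃X : Literature.AlgebraicGeometry.Motives.SchemeOver ℂ⦄, Literature.AlgebraicGeometry.Motives.IsSmoothProjective n X → Nonempty (Literature.AlgebraicGeometry.HodgeTheory.HodgeModel n X)

/-- `HodgeModels` holds: proved by `Summit.HodgeConjecture.HodgeConjecture.Theorems.curveNetMordellWeil_hodgeModels_proof` @ a3022ab2aaa0. -/
theorem HodgeModels_holds : HodgeModels := _root_.Summit.HodgeConjecture.HodgeConjecture.Theorems.curveNetMordellWeil_hodgeModels_proof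

/-- item stmt-HodgeConjecture-3051 · support · rank 9 · open · by planner
sources: Shioda1979HodgeFermat, ShiodaKatsura1979, Aoki1987, Ran1980
[support] MILESTONE: the Hodge conjecture for the Fermat hypersurface X^n_m : Σ x_i^m = 0 in
ℙ^{n+1}_ℂ, for EVERY degree m and dimension n (Motives.IsFermatVariety). Known for m prime or m ≤ 20
(Shioda1979HodgeFermat, Ran1980; further cases Aoki1987); open in general (Shioda's condition
(P^n_m) fails for some composite m). In this route it is LIFT ∧ ENV on the Fermat family: ENV holds
by μ_m^{n+2}-character idempotents, and LIFT is to come from ALG via the supersingular prime p ≡ −1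
(mod m), p > n + 6 (Dirichlet), where X^n_m is unirational and H^{2p}_cris is spanned by cycles
(ShiodaKatsura1979). A counterexample refutes HC itself. Sources: Shioda1979HodgeFermat,
ShiodaKatsura1979, Aoki1987, Ran1980. -/
@[route_item "route-HodgeConjecture-SupersingularIsotypicLift"]
def FermatHodge : Prop :=
  ∀ ⦃n m : ℕ⦄ ⦃X : Literature.AlgebraicGeometry.Motives.SchemeOver ℂ⦄, Literature.AlgebraicGeometry.Motives.IsSmoothProjective n X → Literature.AlgebraicGeometry.Motives.IsFermatVariety n m X → Literature.AlgebraicGeometry.HodgeTheory.HodgeConjectureFor n X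

-- item stmt-HodgeConjecture-3213 · support · rank 9 · open · by planner — informal only, no Lean statement yet:
--   [support] IsotypicPotentiallyTate — the card's unconditional side lemma (provable now in prose;
--   informal until the tree's ℓ-adic Galois realization is tied to Betti isotypic pieces). STATEMENT:
--   let X be smooth projective over a finitely generated field K ⊂ ℂ, and P a ℚ-linear combination of
--   actions of algebraic self-correspondences of X (defined over K) on H²ᵖ such that P(H²ᵖ_B(X_ℂ, ℚ)) ⊗
--   ℂ ⊂ H^{p,p}. Then Gal(K̄/K) acts on N_ℓ := P(H²ᵖ_et(X_K̄, ℚ_ℓ(p))) through a FINITE quotient; in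
--   particular every element of N_ℓ is a Tate class over a finite extension of K, and at every place of
--   good reduct

-- item stmt-HodgeConjecture-3217 · support · rank 9 · open · by planner — informal only, no Lean statement yet:
--   [support] SupersingularSpan (S1 of the card; informal until crystalline cohomology / a crystalline
--   cycle class map lands). (a) FERMAT: for m ≥ 1, n ≥ 1 and a prime p with p ≡ −1 (mod m) (they exist
--   with p > n + 6, Dirichlet), the reduction X₁ = X^n_m ⊗ 𝔽_{p²} is unirational and supersingular, and
--   for every r the cycle classes of codimension-r cycles defined over 𝔽̄_p SPAN H²ʳ_cris(X₁/W) ⊗ K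
--   (equivalently H²ʳ_et(X₁ ⊗ 𝔽̄_p, ℚ_ℓ(r))); hence homological = numerical equivalence ⊗ℚ on X₁ and S
--   := CHʳ(X₁)/num ⊗ ℚ satisfies S ⊗ K ≅ H²ʳ_cris (ShiodaKatsura1979, via the inductive structure;
--   Tate's theor

/-- item stmt-HodgeConjecture-3053 · assembly · rank 1 · closed · proved by Summit.HodgeConjecture.HodgeConjecture.Theorems.supersingularIsotypicLift_assembly_proof @ c81700764b6c (prover) · by planner
sources: Deligne2000
[assembly] OrientationData → HodgeModels → IsotypicClassesAlgebraic → HodgeClassesEnveloped →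
HodgeConjecture. Pure logic (checked in the planner's Sketch.lean: obtain μ; Hodge model from
HodgeModels; for a rational (p,p)-class c, ENV gives γ with P rational-preserving, (p,p)-imaged and
P c = c; LIFT gives c ∈ algebraicClasses X p). The informal rank-2 crux ALG is the intended route
INTO IsotypicClassesAlgebraic and enters the file once typed (split of LIFT into ALG / supersingular
span / BEK criterion). -/
@[route_item "route-HodgeConjecture-SupersingularIsotypicLift"]
def Assembly : Prop :=
  OrientationData → HodgeModels → IsotypicClassesAlgebraic → HodgeClassesEnveloped → HodgeConjecture

-- `Assembly` holds: proved by `Summit.HodgeConjecture.HodgeConjecture.Theorems.supersingularIsotypicLift_assembly_proof` @ c81700764b6c (its module imports this route file, so no `_holds` link can be stated here).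

/-! D-0027 §2.1 — DECIDING THEOREM (planner-authored via `route open/edit --closes-file`; by planner-rbadge-HodgeConjecture-SupersingularIs-b7baa19d-g2-0 2026-08-15T16:11:49Z):
its hypotheses are this route's items and its conclusion the sub-problem Statement (glue_lint), and it elaborates with this file. -/

@[closes "route-HodgeConjecture-SupersingularIsotypicLift"] theorem closes (h₁ : IsotypicClassesAlgebraic) (h₂ : HodgeClassesEnveloped) (h₃ : OrientationData)
    (h₄ : HodgeModels) : HodgeConjecture := by
  intro n X hX
  obtain ⟨μ, hμ⟩ := h₃
  refine ⟨h₄ hX, fun p c hc hpp => ?_⟩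
  obtain ⟨γ, hγ, hrat, hhodge, hfix⟩ := h₂ μ hμ hX p c hc hpp
  exact h₁ μ hμ hX p γ hγ hrat hhodge c hc hfix

end Summit.HodgeConjecture.HodgeConjecture.Theses.SupersingularIsotypicLift
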